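import Mathlib
import HarnessLib
import Summits.HubbardSuperconductivity.HubbardSuperconductivity.Theorems.KLProgrammeKLRegimeTwoVolumeLipDoubledIdentity

/-!
# Route `KLProgramme` — crux K3 ENGINE (stmt-HubbardSuperconductivity-20437), stub (e) proof-input «(e)-D-ROWS», keying (A′), REKEY-D file D4a:
# THE DOUBLED BORN DIFFERENCE AT A PIN = LIP + SRC (seat hubbard-kl-k3c4-p1 g27; doubled twin of ✓ `…TwoVolumeLipSourceTransfer.sum_pinned_norm_kernel_klLipBornDiff_le_of_parts`)

* **`sum_pinned_norm_kernel_klLipBornDiffD_le_of_parts`** — at any pin `(i, w″)` of either copy, the pinned kernel sum of `klLipBornDiffD L b M … d k` is at most a bound `B₁` of the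
  Lipschitz part (the left side of ✓ D2 `lipBlockStepD_deep_rate_le`) plus a bound `B₂` of the source in transfer form (the left side of ✓ D3b `lipSourceTransferD_le(_of_wtRows)`):
  D1 `klLipBornDiffD_eq_lip_add_src`, `kernel_add`, triangle.  With D2 + D3b this is the (Db)⁺ row of the doubled tower modulo the choice of majorants (next file D4).

Pure composition; nothing asserts the (D) rows, (e), VL, K3 or superconductivity.  References: BGM 2006 §2.7 (2.70)–(2.71) [cite: BenfattoGiulianiMastropietro2006].
-/

noncomputable section

namespace Summit.HubbardSuperconductivity.HubbardSuperconductivity.Theorems.TwoVolumeLip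

set_option linter.dupNamespace false -- summit = problem name (single-conjunct summit), D-0017

open Finset Literature.MathematicalPhysics.QuantumLattice GrassmannAlgebra Literature.Probability.LatticeModels
open Literature.MathematicalPhysics.QuantumLattice.FermiRG
open Summit.HubbardSuperconductivity.HubbardSuperconductivity.Theorems.KLRegimeSplit
open Summit.HubbardSuperconductivity.HubbardSuperconductivity.Theorems.KLProgrammeLegKernels
open Summit.HubbardSuperconductivity.HubbardSuperconductivity.Theorems.EngineV8
open Summit.HubbardSuperconductivity.HubbardSuperconductivity.Theorems.TwoVolumeSource
open Summit.HubbardSuperconductivity.HubbardSuperconductivity.Theorems.TwoVolumeDefect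

/-! ## D4a The doubled born difference at a pin = LIP + SRC (triangle on D1's split) -/

section PartsD

variable {L b M : ℕ} [NeZero L] [NeZero (b * L)] [NeZero M]

/-- **The doubled born difference of block `k` as LIP + SRC at any pin**: a bound `B₁` of the Lipschitz part (the left side of D2 `lipBlockStepD_deep_rate_le`) plus a bound `B₂`
of the source in transfer form (the left side of D3b `lipSourceTransferD_le(_of_wtRows)`) bound the pinned kernel sum of `klLipBornDiffD … d k` (D1 `klLipBornDiffD_eq_lip_add_src`,
`kernel_add`, triangle). Doubled twin of ✓ `sum_pinned_norm_kernel_klLipBornDiff_le_of_parts`. [cite: BenfattoGiulianiMastropietro2006, §2.7 (2.70)-(2.71)] -/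
theorem sum_pinned_norm_kernel_klLipBornDiffD_le_of_parts {β : ℝ} (hβ : β ≠ 0) (U μ : ℝ) (K : TrigPolyC4v) {d k : ℕ} (hdk : 1 ≤ d * k)
    (hZ : hubbardEffPartitionFnCT (b * L) M β U μ 0 K (klScale klE0 (d * k)) ≠ 0)
    {m : ℕ} (i : Fin m) (w'' : SrcLabel (b * L) M (d * k)) {B₁ B₂ : ℝ}
    (h₁ : ∑ X'' ∈ univ.filter (fun X'' : Fin m → SrcLabel (b * L) M (d * k) => X'' i = w''),
      ‖kernel ℂ (ExteriorAlgebra.map (Matrix.toLin' (klLipTransferD (b * L) M β μ K d k))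
          ((effAction ℂ (klLipCovD (b * L) M β μ K d k)
                (klGlueD L b M (d * k - 1) (klLipInputD L M β U μ K d k) + klLipInputDiffD L b M β U μ K d k) -
              (klGlueD L b M (d * k - 1) (klLipInputD L M β U μ K d k) + klLipInputDiffD L b M β U μ K d k)) -
            (effAction ℂ (klLipCovD (b * L) M β μ K d k) (klGlueD L b M (d * k - 1) (klLipInputD L M β U μ K d k)) -
              klGlueD L b M (d * k - 1) (klLipInputD L M β U μ K d k)))) m X''‖ ≤ B₁)
    (h₂ : ∑ X'' ∈ univ.filter (fun X'' : Fin m → SrcLabel (b * L) M (d * k) => X'' i = w''),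
      ‖kernel ℂ (ExteriorAlgebra.map (Matrix.toLin' (klLipTransferD (b * L) M β μ K d k))
              (effAction ℂ (klLipCovD (b * L) M β μ K d k) (klGlueD L b M (d * k - 1) (klLipInputD L M β U μ K d k)) -
                klGlueD L b M (d * k - 1) (klLipInputD L M β U μ K d k)) -
          klGlueD L b M (d * k) (klLipBornD L M β U μ K d k)) m X''‖ ≤ B₂) :
    ∑ X'' ∈ univ.filter (fun X'' : Fin m → SrcLabel (b * L) M (d * k) => X'' i = w''),
        ‖kernel ℂ (klLipBornDiffD L b M β U μ K d k) m X''‖ ≤ B₁ + B₂ := by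
  rw [klLipBornDiffD_eq_lip_add_src hβ U μ K hdk hZ]
  have hsplit : ∀ X'' : Fin m → SrcLabel (b * L) M (d * k),
      ‖kernel ℂ ((ExteriorAlgebra.map (Matrix.toLin' (klLipTransferD (b * L) M β μ K d k))
            (effAction ℂ (klLipCovD (b * L) M β μ K d k)
                (klGlueD L b M (d * k - 1) (klLipInputD L M β U μ K d k) + klLipInputDiffD L b M β U μ K d k) -
              (klGlueD L b M (d * k - 1) (klLipInputD L M β U μ K d k) + klLipInputDiffD L b M β U μ K d k)) -
          ExteriorAlgebra.map (Matrix.toLin' (klLipTransferD (b * L) M β μ K d k))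
            (effAction ℂ (klLipCovD (b * L) M β μ K d k) (klGlueD L b M (d * k - 1) (klLipInputD L M β U μ K d k)) -
              klGlueD L b M (d * k - 1) (klLipInputD L M β U μ K d k))) +
        (ExteriorAlgebra.map (Matrix.toLin' (klLipTransferD (b * L) M β μ K d k))
            (effAction ℂ (klLipCovD (b * L) M β μ K d k) (klGlueD L b M (d * k - 1) (klLipInputD L M β U μ K d k)) -
              klGlueD L b M (d * k - 1) (klLipInputD L M β U μ K d k)) -
          klGlueD L b M (d * k) (klLipBornD L M β U μ K d k))) m X''‖ ≤
      ‖kernel ℂ (ExteriorAlgebra.map (Matrix.toLin' (klLipTransferD (b * L) M β μ K d k))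
          ((effAction ℂ (klLipCovD (b * L) M β μ K d k)
                (klGlueD L b M (d * k - 1) (klLipInputD L M β U μ K d k) + klLipInputDiffD L b M β U μ K d k) -
              (klGlueD L b M (d * k - 1) (klLipInputD L M β U μ K d k) + klLipInputDiffD L b M β U μ K d k)) -
            (effAction ℂ (klLipCovD (b * L) M β μ K d k) (klGlueD L b M (d * k - 1) (klLipInputD L M β U μ K d k)) -
              klGlueD L b M (d * k - 1) (klLipInputD L M β U μ K d k)))) m X''‖ +
      ‖kernel ℂ (ExteriorAlgebra.map (Matrix.toLin' (klLipTransferD (b * L) M β μ K d k))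
              (effAction ℂ (klLipCovD (b * L) M β μ K d k) (klGlueD L b M (d * k - 1) (klLipInputD L M β U μ K d k)) -
                klGlueD L b M (d * k - 1) (klLipInputD L M β U μ K d k)) -
          klGlueD L b M (d * k) (klLipBornD L M β U μ K d k)) m X''‖ := by
    intro X''
    rw [kernel_add, ← map_sub]
    exact norm_add_le _ _
  refine le_trans (Finset.sum_le_sum fun X'' _ => hsplit X'') ?_
  rw [Finset.sum_add_distrib]
  exact add_le_add h₁ h₂

end PartsD

end Summit.HubbardSuperconductivity.HubbardSuperconductivity.Theorems.TwoVolumeLip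

end
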